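import Summits.ResolutionOfSingularities.ResolutionOfSingularities.Theorems.PurelyInseparableDim4WinCertFlatSound
import HarnessLib
import HarnessLib.Audit.Tags

/-!
# Purely inseparable fourfolds — in-scope win certificates over EVERY field of characteristic `p` with FLATS AND
# SUBSTITUTION LEAVES (FCert v2): cover witnesses with polynomial factors, leaves, and THE COVER
# [OURS · counted 0 · a certificate format for OUR frame v4, not about resolution]

Census cell «res-dim4-pi» (D-0157 DOOR 2), desk WORD #111 (b); seat res-rescue-typ-3 g9 (rescue base on loan per
director-resolution DR-E8 (4)).  Sequel of res-rescue-typ-3 g8's `…WinCertFlat` / `…WinCertFlatSound` (`FWit`, `Flat`,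
`coverOKL`, `rational_or_onFlatL`, `fwinCertBL`).  Those certificates cover the `q`-fold locus on the exceptional divisor of
a chart by `𝔽_p`-RATIONAL points (children certified later) and COORDINATE FLATS (base child absorbed by
`…FlatAbsorb`).  res-dim4-eng-w2 g2's «EN-9 on E» census found the remaining obstruction to be NON-FLAT components `Z`
of that locus which are UNIFORM-OUT (every `K`-point of `Z` gives a child OUT of coordinate scope), and res-dim4-p-8 g3's
`ScopeBlind.not_inCoordinateScope_step_of_subst` (`…ScopeBlindSubst`) proves exactly that for `Z = {b : σ(b) = b}`, the
fixed locus of a polynomial substitution `σ` killing `J_q⁺(G)`.  THIS FILE is the COVER half of the matching certificate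
kind (the row checker and its soundness are the sequel `…WinCertSubstSound`):

* `SWit` — a cover witness for chart `j`, coordinate `i`, linear factors `lin = [(t, c), …]` (one per flat, `x_t − c`)
  and SUBSTITUTION FACTORS `sub = [(P, i'), …]` (one per leaf, `P − x_{i'}` with `P = σ(x_{i'})`): an identity
  `Σ_α g_α·D^{(α)}G + h·x_j = ((x_i^p − x_i)·Π (x_t − c)·Π (P − x_{i'}))^N` (`switB`); at an equimultiple `K`-point
  `b` (`b_j = 0`) it gives `b_i ∈ 𝔽_p` unless some `b_t = c` or some `P(b) = b_{i'}` (`pow_eq_zero_of_switB`).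
* `SLeaf` — `(j, σ, T, α₀, tests)`: the leaf `Z_σ = {b : ∀ i, σ_i(b) = b_i}` of chart `j` (`OnLeaf`), with the list
  `tests` of coordinates where `σ_i ≠ x_i` can fail (`testsOKB`: every other `i` has `σ_i = x_i` verbatim, or `i = j`
  and `σ_j = 0`), so that a point OFF the leaf differs from `σ` at a TEST coordinate (`exists_test_of_not_onLeaf`).
* `scoverOKL p q s S j wits flats leaves` — for every `i ≠ j`, every choice of one fixed coordinate per flat of the chart
  AND one test coordinate per leaf of the chart, a passing `SWit` with exactly those factors; hence **THE COVER**
  `rational_or_onFlat_or_onLeaf`: every equimultiple `K`-point of the chart is `𝔽_p`-rational, or on a flat, or on a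
  leaf.  (That the leaf's points are blind is NOT checked here — that is p-8's `substBlindB`, consumed by the sequel.)
Nothing here proves resolution of singularities in dimension ≥ 4 / characteristic `p`; F4-C(2,2) stays OPEN; counted 0;
AI work, weaker than expert review.  bears_on: LADDER-RESOLUTION:D157-DOOR2 (res-dim4-pi · F4-C ∀K column · FCert v2).
Supports stmt-ResolutionOfSingularities-16155 (helper).
-/

set_option linter.dupNamespace false

noncomputable section
open MvPolynomial Finset
open scoped BigOperators
namespace Summit.ResolutionOfSingularities.ResolutionOfSingularities.Theorems.PIDim4

namespace WinCertSubst

open Literature.AlgebraicGeometry.Resolution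
open Literature.AlgebraicGeometry.Resolution.CentreBlowup
open StepKit WinCertSound InScopeWinCert ScopeCover ScopeBlind WinCertAllFields WinCertFlat

variable {k : Type} [Field k] [DecidableEq k]

/-! ## 1. Cover witnesses with linear and substitution factors -/

/-- A **cover witness** of FCert v2: chart `j`, coordinate `i`, exponent `N`, linear factors `(t, c)` for `x_t − c`,
substitution factors `(P, i')` for `P − x_{i'}`, cofactors `g_α` of the Hasse derivatives and `h` of `x_j`; it claims
`Σ_α g_α·D^{(α)}G + h·x_j = ((x_i^p − x_i)·Π (x_t − c)·Π (P − x_{i'}))^N`. [folklore] -/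
structure SWit (k : Type) where
  /-- the chart variable -/
  j : Fin 4
  /-- the coordinate forced rational off the flats and leaves -/
  i : Fin 4
  /-- the exponent `N` -/
  N : ℕ
  /-- the linear factors `x_t − c`, one per flat of the chart -/
  lin : List (Fin 4 × k)
  /-- the substitution factors `P − x_{i'}`, one per leaf of the chart -/
  sub : List (Terms 4 k × Fin 4)
  /-- cofactors of the Hasse derivatives, as (multi-index, term list) -/
  gs : List ((Fin 4 → ℕ) × Terms 4 k)
  /-- cofactor of `x_j` -/
  h : Terms 4 k

/-- The term list of `P − x_{i'}`. [folklore] -/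
def subL (Pi : Terms 4 k × Fin 4) : Terms 4 k := Pi.1 ++ [(unitE Pi.2 1, -1)]

/-- The term list of `Π (P − x_{i'})`. [folklore] -/
def subProdL : List (Terms 4 k × Fin 4) → Terms 4 k
  | [] => [(fun _ => 0, 1)]
  | Pi :: rest => mulL (subL Pi) (subProdL rest)

/-- **Checking a cover witness** on the chart transform `G` (term list): multi-indices in `0 < |α| < q` and the
identity `Σ_α g_α·D^{(α)}G + h·x_j = ((x_i^p − x_i)·Π (x_t − c)·Π (P − x_{i'}))^N` after collecting terms. [folklore] -/
def switB (p q : ℕ) (G : Terms 4 k) (w : SWit k) : Bool :=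
  (w.gs.all fun ag => decide (0 < ∑ l, ag.1 l ∧ ∑ l, ag.1 l < q)) &&
    StepKit.equivB (normL (witLHS G ⟨w.j, w.i, w.N, w.gs, w.h⟩))
      (normL (powL (mulL (mulL (xPowSubX p w.i) (linProdL w.lin)) (subProdL w.sub)) w.N))

omit [DecidableEq k] in
/-- `eval₂Hom f b (P − x_{i'}) = eval₂Hom f b P − b_{i'}`. [folklore] -/
theorem eval₂Hom_subL {K : Type} [Field K] (f : k →+* K) (b : Fin 4 → K) (Pi : Terms 4 k × Fin 4) :
    eval₂Hom f b (evalT (subL Pi)) = eval₂Hom f b (evalT Pi.1) - b Pi.2 := by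
  rw [subL, evalT_append, map_add]
  simp only [evalT_cons, evalT_nil, add_zero, eval₂Hom_monomial_expo, prod_pow_unitE, pow_one, map_neg, map_one]
  ring

omit [DecidableEq k] in
/-- `eval₂Hom f b (Π (P − x_{i'})) = Π (eval₂Hom f b P − b_{i'})`. [folklore] -/
theorem eval₂Hom_subProdL {K : Type} [Field K] (f : k →+* K) (b : Fin 4 → K) :
    ∀ sub : List (Terms 4 k × Fin 4),
      eval₂Hom f b (evalT (subProdL sub)) = (sub.map fun Pi => eval₂Hom f b (evalT Pi.1) - b Pi.2).prod
  | [] => by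
    simp only [subProdL, evalT_cons, evalT_nil, add_zero, eval₂Hom_monomial_expo, pow_zero,
      Finset.prod_const_one, mul_one, map_one, List.map_nil, List.prod_nil]
  | Pi :: rest => by
    rw [subProdL, evalT_mulL, map_mul, eval₂Hom_subL, eval₂Hom_subProdL f b rest, List.map_cons, List.prod_cons]

/-- **Soundness of a cover witness**: at a `K`-point `b` with `b_j = 0` where every Hasse derivative `D^{(α)}G`,
`0 < |α| < q`, vanishes (after `f`), `((b_i^p − b_i)·Π (b_t − f c)·Π (P(b) − b_{i'}))^N = 0`. [folklore] -/
theorem pow_eq_zero_of_switB {p q : ℕ} {G : Terms 4 k} {w : SWit k} (hw : switB p q G w = true)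
    {K : Type} [Field K] (f : k →+* K) (b : Fin 4 → K) (hbj : b w.j = 0)
    (hzero : ∀ α : Fin 4 → ℕ, 0 < ∑ l, α l → ∑ l, α l < q →
      eval₂Hom f b (hasseDeriv (expo α) (evalT G)) = 0) :
    ((b w.i ^ p - b w.i) * (w.lin.map fun tc => b tc.1 - f tc.2).prod *
        (w.sub.map fun Pi => eval₂Hom f b (evalT Pi.1) - b Pi.2).prod) ^ w.N = 0 := by
  unfold switB at hw
  rw [Bool.and_eq_true, List.all_eq_true] at hw
  obtain ⟨hdeg, hequiv⟩ := hw
  have hid : evalT (witLHS G ⟨w.j, w.i, w.N, w.gs, w.h⟩) =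
      evalT (powL (mulL (mulL (xPowSubX p w.i) (linProdL w.lin)) (subProdL w.sub)) w.N) := by
    rw [← evalT_normL (witLHS G _), ← evalT_normL (powL _ _)]
    exact (evalT_eq_iff_equivB _ _).mpr hequiv
  have hl : eval₂Hom f b (evalT (witLHS G ⟨w.j, w.i, w.N, w.gs, w.h⟩)) = 0 := by
    rw [witLHS, evalT_append, map_add, evalT_mulL, map_mul]
    rw [eval₂Hom_sumHasseL_eq_zero f b G w.gs fun ag hag => ?_]
    · simp only [evalT_cons, evalT_nil, add_zero, eval₂Hom_monomial_expo, prod_pow_unitE, pow_one, hbj,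
        map_one, mul_zero]
    · have hd := of_decide_eq_true (hdeg ag hag)
      exact hzero ag.1 hd.1 hd.2
  have hr : eval₂Hom f b (evalT (powL (mulL (mulL (xPowSubX p w.i) (linProdL w.lin)) (subProdL w.sub)) w.N)) =
      ((b w.i ^ p - b w.i) * (w.lin.map fun tc => b tc.1 - f tc.2).prod *
        (w.sub.map fun Pi => eval₂Hom f b (evalT Pi.1) - b Pi.2).prod) ^ w.N := by
    rw [evalT_powL, map_pow, evalT_mulL, map_mul, evalT_mulL, map_mul, eval₂Hom_xPowSubX, eval₂Hom_linProdL,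
      eval₂Hom_subProdL]
  rw [← hr, ← hid, hl]

/-! ## 2. Substitution leaves -/

/-- A **substitution leaf** of chart `j`: the substitution `σ` (term lists; `σ_i = 0` on `T`), the coordinates `T`
claimed to vanish on the leaf, the multi-index `α₀` of the uniform non-vanishing, and the TEST coordinates (those `i`
with `σ_i ≠ x_i` other than a killed chart variable).  Its `K`-points are the `b` with `σ_i(b) = b_i` for all `i`.
[folklore] -/
structure SLeaf (k : Type) where
  /-- the chart variable -/
  j : Fin 4
  /-- the substitution, as term lists -/
  σ : Fin 4 → Terms 4 k
  /-- the killed coordinates -/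
  T : Finset (Fin 4)
  /-- the multi-index of the uniform non-vanishing -/
  α₀ : Fin 4 → ℕ
  /-- the test coordinates -/
  tests : List (Fin 4)

/-- `b` lies on the leaf `ℓ` (read in `K` through `f`): `σ_i(b) = b_i` for every `i`. [folklore] -/
def OnLeaf {K : Type} [Field K] (f : k →+* K) (ℓ : SLeaf k) (b : Fin 4 → K) : Prop :=
  ∀ i : Fin 4, eval₂Hom f b (evalT (ℓ.σ i)) = b i

/-- Decidable form of `OnLeaf (RingHom.id k)`. [folklore] -/
def onLeafB (ℓ : SLeaf k) (b : Fin 4 → k) : Bool :=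
  decide (∀ i : Fin 4, eval₂Hom (RingHom.id k) b (evalT (ℓ.σ i)) = b i)

/-- **The test coordinates are complete**: every coordinate is a test coordinate, or `σ_i = x_i` verbatim, or it is
the chart variable with `σ_j = 0` verbatim. [folklore] -/
def testsOKB (ℓ : SLeaf k) : Bool :=
  decide (∀ i : Fin 4, i ∈ ℓ.tests ∨ ℓ.σ i = [(unitE i 1, 1)] ∨ (i = ℓ.j ∧ ℓ.σ i = []))

omit [DecidableEq k] in
/-- `eval₂Hom f b (x_i) = b_i` for the verbatim term list `[(e_i, 1)]`. [folklore] -/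
theorem eval₂Hom_X_terms {K : Type} [Field K] (f : k →+* K) (b : Fin 4 → K) (i : Fin 4) :
    eval₂Hom f b (evalT ([(unitE i 1, (1 : k))] : Terms 4 k)) = b i := by
  simp only [evalT_cons, evalT_nil, add_zero, eval₂Hom_monomial_expo, prod_pow_unitE, pow_one, map_one, one_mul]

/-- **A point off the leaf differs from `σ` at a test coordinate** (for `b_j = 0`). [folklore] -/
theorem exists_test_of_not_onLeaf {K : Type} [Field K] (f : k →+* K) {ℓ : SLeaf k} (ht : testsOKB ℓ = true)
    {b : Fin 4 → K} (hbj : b ℓ.j = 0) (hnot : ¬ OnLeaf f ℓ b) :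
    ∃ i ∈ ℓ.tests, eval₂Hom f b (evalT (ℓ.σ i)) - b i ≠ 0 := by
  classical
  unfold OnLeaf at hnot
  push Not at hnot
  obtain ⟨i, hi⟩ := hnot
  have hall := of_decide_eq_true ht i
  rcases hall with h | h | ⟨rfl, h⟩
  · exact ⟨i, h, sub_ne_zero.mpr hi⟩
  · exact absurd (by rw [h, eval₂Hom_X_terms]) hi
  · exact absurd (by rw [h, evalT_nil, map_zero, hbj]) hi

/-- A `k`-rational point on a leaf (Boolean form) is on the leaf over `K`. [folklore] -/
theorem onLeaf_of_onLeafB {K : Type} [Field K] (f : k →+* K) {ℓ : SLeaf k} {b₀ : Fin 4 → k}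
    (h : onLeafB ℓ b₀ = true) : OnLeaf f ℓ (f ∘ b₀) := by
  unfold onLeafB at h
  intro i
  have hi := of_decide_eq_true h i
  have hcomp : eval₂Hom f (f ∘ b₀) (evalT (ℓ.σ i)) = f (eval₂Hom (RingHom.id k) b₀ (evalT (ℓ.σ i))) := by
    rw [show eval₂Hom f (f ∘ b₀) = f.comp (eval₂Hom (RingHom.id k) b₀) from ?_]
    · rfl
    · refine MvPolynomial.ringHom_ext (fun c => ?_) (fun n => ?_)
      · simp
      · simp
  rw [hcomp, hi, Function.comp_apply]

/-! ## 3. The cover check and THE COVER -/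

/-- **A witness with prescribed chart, coordinate and factors passes.** [folklore] -/
def switForB (p q : ℕ) (G : Terms 4 k) (j i : Fin 4) (lin : List (Fin 4 × k)) (sub : List (Terms 4 k × Fin 4))
    (w : SWit k) : Bool :=
  decide (w.j = j) && decide (w.i = i) && decide (w.lin = lin) && decide (w.sub = sub) && switB p q G w

/-- Unpacking `switForB`. [folklore] -/
theorem switForB_spec {p q : ℕ} {G : Terms 4 k} {j i : Fin 4} {lin : List (Fin 4 × k)}
    {sub : List (Terms 4 k × Fin 4)} {w : SWit k} (h : switForB p q G j i lin sub w = true) :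
    w.j = j ∧ w.i = i ∧ w.lin = lin ∧ w.sub = sub ∧ switB p q G w = true := by
  unfold switForB at h
  simp only [Bool.and_eq_true, decide_eq_true_eq] at h
  exact ⟨h.1.1.1.1, h.1.1.1.2, h.1.1.2, h.1.2, h.2⟩

/-- **The cover check of chart `j`** (FCert v2): for every `i ≠ j`, every choice `τ` of one fixed coordinate per flat
of the chart and every choice `ρ` of one test coordinate per leaf of the chart, a passing cover witness with exactly
those linear and substitution factors. [folklore] -/
def scoverOKL (p q : ℕ) (s : SData 4 k) (S : Finset (Fin 4)) (j : Fin 4) (wits : List (SWit k))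
    (flats : List (Flat k)) (leaves : List (SLeaf k)) : Bool :=
  decide (∀ i : Fin 4, i ≠ j →
    ∀ τ ∈ ((flats.filter fun φ : Flat k => decide (φ.j = j)).map fixedCoordsL).sections,
      ∀ ρ ∈ ((leaves.filter fun ℓ : SLeaf k => decide (ℓ.j = j)).map SLeaf.tests).sections,
        ∃ w ∈ wits, switForB p q (chartL q S j s.L) j i
          (List.zipWith (fun (φ : Flat k) (t : Fin 4) => (t, φ.b0 t))
            (flats.filter fun φ : Flat k => decide (φ.j = j)) τ)
          (List.zipWith (fun (ℓ : SLeaf k) (t : Fin 4) => (ℓ.σ t, t))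
            (leaves.filter fun ℓ : SLeaf k => decide (ℓ.j = j)) ρ) w = true)

/-- If `b` is on no leaf of the list (all with complete tests and chart `j`, `b_j = 0`), one can choose a test
coordinate per leaf where `σ(b)` differs from `b`, and the choice is a section of the tests. [folklore] -/
theorem exists_section_of_forall_not_onLeaf {K : Type} [Field K] (f : k →+* K) {j : Fin 4} {b : Fin 4 → K}
    (hbj : b j = 0) :
    ∀ (leaves : List (SLeaf k)), (∀ ℓ ∈ leaves, ℓ.j = j) → (∀ ℓ ∈ leaves, testsOKB ℓ = true) →
      (∀ ℓ ∈ leaves, ¬ OnLeaf f ℓ b) →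
      ∃ ρ ∈ (leaves.map SLeaf.tests).sections,
        ((List.zipWith (fun (ℓ : SLeaf k) (t : Fin 4) => (ℓ.σ t, t)) leaves ρ).map
          fun Pi : Terms 4 k × Fin 4 => eval₂Hom f b (evalT Pi.1) - b Pi.2).prod ≠ 0
  | [], _, _, _ => ⟨[], by simp [List.sections], by simp⟩
  | ℓ :: rest, hj, ht, hnot => by
    classical
    obtain ⟨ρ, hρ, hprod⟩ := exists_section_of_forall_not_onLeaf f hbj rest
      (fun ψ hψ => hj ψ (List.mem_cons_of_mem _ hψ)) (fun ψ hψ => ht ψ (List.mem_cons_of_mem _ hψ))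
      (fun ψ hψ => hnot ψ (List.mem_cons_of_mem _ hψ))
    have hℓj : ℓ.j = j := hj ℓ List.mem_cons_self
    obtain ⟨t, htT, hne⟩ := exists_test_of_not_onLeaf f (ht ℓ List.mem_cons_self) (by rw [hℓj]; exact hbj)
      (hnot ℓ List.mem_cons_self)
    refine ⟨t :: ρ, ?_, ?_⟩
    · rw [List.map_cons, List.sections]
      simp only [List.mem_flatMap, List.mem_map]
      exact ⟨ρ, hρ, t, htT, rfl⟩
    · rw [List.zipWith_cons_cons, List.map_cons, List.prod_cons]
      exact mul_ne_zero hne hprod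

/-- **THE COVER** (FCert v2): at a chart `j` passing `scoverOKL`, every equimultiple `K`-point `b` (`b_j = 0`) is
`f ∘ b₀` for a `k`-point `b₀` with `b₀ j = 0`, or lies on a flat of the chart, or lies on a leaf of the chart.
[folklore] -/
theorem rational_or_onFlat_or_onLeaf {p : ℕ} [Fact p.Prime] {q : ℕ} {K : Type} [Field K] [CharP K p]
    [DecidableEq K] (f : ZMod p →+* K) {s : SData 4 (ZMod p)} {S : Finset (Fin 4)} {j : Fin 4}
    {wits : List (SWit (ZMod p))} {flats : List (Flat (ZMod p))} {leaves : List (SLeaf (ZMod p))}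
    (hcov : scoverOKL p q s S j wits flats leaves = true)
    (h0 : ∀ φ ∈ flats, φ.b0 φ.j = 0) (ht : ∀ ℓ ∈ leaves, testsOKB ℓ = true) {b : Fin 4 → K} (hbj : b j = 0)
    (heq : IsEquimultiplePoint q S j b (⟨MvPolynomial.map f s.toState.F, s.toState.r, s.toState.exc⟩ : State K)) :
    (∃ b₀ : Fin 4 → ZMod p, b₀ j = 0 ∧ f ∘ b₀ = b) ∨ (∃ φ ∈ flats, φ.j = j ∧ OnFlat f φ b) ∨
      ∃ ℓ ∈ leaves, ℓ.j = j ∧ OnLeaf f ℓ b := by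
  classical
  by_cases hflat : ∃ φ ∈ flats, φ.j = j ∧ OnFlat f φ b
  · exact Or.inr (Or.inl hflat)
  by_cases hleaf : ∃ ℓ ∈ leaves, ℓ.j = j ∧ OnLeaf f ℓ b
  · exact Or.inr (Or.inr hleaf)
  left
  push Not at hflat hleaf
  unfold scoverOKL at hcov
  have hall := of_decide_eq_true hcov
  set fl := flats.filter fun φ : Flat (ZMod p) => decide (φ.j = j) with hfl
  set lv := leaves.filter fun ℓ : SLeaf (ZMod p) => decide (ℓ.j = j) with hlv
  have hflj : ∀ φ ∈ fl, φ.j = j := fun φ hφ => of_decide_eq_true (List.mem_filter.mp hφ).2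
  have hfl0 : ∀ φ ∈ fl, φ.b0 φ.j = 0 := fun φ hφ => h0 φ (List.mem_filter.mp hφ).1
  have hnotf : ∀ φ ∈ fl, ¬ OnFlat f φ b := fun φ hφ => hflat φ (List.mem_filter.mp hφ).1 (hflj φ hφ)
  have hlvj : ∀ ℓ ∈ lv, ℓ.j = j := fun ℓ hℓ => of_decide_eq_true (List.mem_filter.mp hℓ).2
  have hlvt : ∀ ℓ ∈ lv, testsOKB ℓ = true := fun ℓ hℓ => ht ℓ (List.mem_filter.mp hℓ).1
  have hnotl : ∀ ℓ ∈ lv, ¬ OnLeaf f ℓ b := fun ℓ hℓ => hleaf ℓ (List.mem_filter.mp hℓ).1 (hlvj ℓ hℓ)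
  obtain ⟨τ, hτ, hprodτ⟩ := exists_sectionL_of_forall_not_onFlat f hbj fl hflj hfl0 hnotf
  obtain ⟨ρ, hρ, hprodρ⟩ := exists_section_of_forall_not_onLeaf f hbj lv hlvj hlvt hnotl
  have hcoord : ∀ i : Fin 4, ∃ c : ZMod p, f c = b i := by
    intro i
    by_cases hij : i = j
    · exact ⟨0, by rw [map_zero, hij, hbj]⟩
    · obtain ⟨w, -, hwf⟩ := hall i hij τ hτ ρ hρ
      obtain ⟨hwj, hwi, hwlin, hwsub, hw⟩ := switForB_spec hwf
      have hpow := pow_eq_zero_of_switB hw f b (by rw [hwj]; exact hbj)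
        (fun α hα0 hαq => eval₂Hom_hasseDeriv_eq_zero_of_isEquimultiplePoint f s heq α hα0 hαq)
      rw [hwi, hwlin, hwsub] at hpow
      rcases Nat.eq_zero_or_pos w.N with hN | hN
      · rw [hN, pow_zero] at hpow; exact absurd hpow one_ne_zero
      have hmul := (pow_eq_zero_iff hN.ne').mp hpow
      rcases mul_eq_zero.mp hmul with h12 | h3
      · rcases mul_eq_zero.mp h12 with h1 | h2
        · exact exists_eq_cast_of_pow_char_eq f (sub_eq_zero.mp h1)
        · exact absurd h2 hprodτ
      · exact absurd h3 hprodρ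
  choose b₀ hb₀ using hcoord
  refine ⟨b₀, ?_, funext fun i => hb₀ i⟩
  have : f (b₀ j) = f 0 := by rw [hb₀ j, hbj, map_zero]
  exact f.injective this

omit [DecidableEq k] in
/-- On a leaf, `b` is fixed by `σ` read through `f`: the hypothesis shape of
`ScopeBlind.not_inCoordinateScope_step_of_subst` with `σ_K i = MvPolynomial.map f (evalT (σ i))`. [folklore] -/
theorem eval_map_eq_of_onLeaf {K : Type} [Field K] (f : k →+* K) {ℓ : SLeaf k} {b : Fin 4 → K}
    (h : OnLeaf f ℓ b) (i : Fin 4) : MvPolynomial.eval b (MvPolynomial.map f (evalT (ℓ.σ i))) = b i := by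
  rw [MvPolynomial.eval_map, ← MvPolynomial.coe_eval₂Hom]
  exact h i

end WinCertSubst

end Summit.ResolutionOfSingularities.ResolutionOfSingularities.Theorems.PIDim4

end
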